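import Mathlib
import HarnessLib
import Summits.HubbardSuperconductivity.HubbardSuperconductivity.Theorems.KLProgrammeKLRegimeSplitPhRotationLattice
import Summits.HubbardSuperconductivity.HubbardSuperconductivity.Theorems.KLProgrammeKLRegimeSplitBornOddnessRow

/-!
# Route `KLProgramme` — ENGINE (stmt-HubbardSuperconductivity-20437 `KLRegimeEngineV17F2`), row (c) binder #8 (v19 `hexLadMV`), cure of located #23, brick O6c (row form):
# THE FREQUENCY-PINNED PART OF THE ZERO-TRANSFER p-h VALUE ROW IN THE ROWS DOOR'S OWN SPELLING — `Ẇ_t(p)(βL²ĝ)·Φ_j(t)(p)(βL²ĝ)` against a `p`-independent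
# kernel product `V₀(σ)`, in the born normalisation `(Λₙ−Λₙ₊₁)((βL²)³)⁻¹`, is `(Λₙ−Λₙ₊₁)·‖Σ_σV₀(σ)‖ × (thermal + DOS-slope + lattice)` — not `× 1/Λ`
# (cell gate-hubbard-kl, seat hubbard-kl-k3c2-p2 g31, technique «thermal-bar induction n ≤ nScales β + 1 with EngineBoundsAtV4S sums»)

WHY.  Located #23 (k3c1-p1 g26): at the diagonal `k′ = k` the `M4² × MASS` form of binder #8's p-h rows charges `2048·15367·M4²`, n-flat, homeless below the
p-h plateau; the cure level `hexLadMV` (v19) carries the rows as VALUES.  The value's leading part (kernels frozen at the pinned frequencies/momenta, `V₀`) is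
exactly the object of the rotation lemma: `Σ_p Ẇ_tĝ·Φ_jĝ·V₀ = (βL²)²·V₀·Σ_p G(s_p)ĝ_p²`, `G = klWd Λ(t)·klPhi Λ_j Λ(t)` radial, and O6a/O6b bound
`β⁻¹(L²)⁻¹Σ_p Gĝ²` by thermal + DOS-slope + lattice sizes.  This file is the twin of `klok_localisedBorn_row_le` (O5b) for that piece:

* **`klph_phValue_row_le`** — for `t ∈ [0,1]`, a member scale `Λ_j`, the STEP's literal weights `Wd`, `Φ`, a kernel product `V₀ : Fin 2 → ℂ`, slice-weight data
  `(M_G, ℓ, r₁)` of `klWd Λ(t)·klPhi Λ_j Λ(t)` (`klok_bornKernel_hypotheses`), under the C4a chart hypotheses with `Λ(t) < r`, `0 < β`, `βΛ(t)/(2π) + 1 ≤ M`: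
  `(Λₙ−Λₙ₊₁)((βL²)³)⁻¹·‖Σ_p Σ_σ (Wd t p·βL²ĝ_p)(Φ j t p·βL²ĝ_p)·V₀ σ‖ ≤ (Λₙ−Λₙ₊₁)·‖Σ_σ V₀ σ‖·𝔅₆_b(Λ(t))`, `𝔅₆_b` the bound of `klph_lattice_rotation_le'`.
The kernels' own transfer/frequency moduli (`V(p)V(p) − V₀`) × the (E.5d) gain are the E1 row of E1-LEDGER rev 12 line #8; not here.
Pure composition; no definitions; nothing asserts (c), K3 or superconductivity.  [cite: BenfattoGiulianiMastropietro2006, §2.4–§2.5]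
-/

noncomputable section

namespace Summit.HubbardSuperconductivity.HubbardSuperconductivity.Theorems.KLRegimeSplit

set_option linter.dupNamespace false -- summit = problem name (single-conjunct summit), D-0017

open Real Set Finset Literature.MathematicalPhysics.QuantumLattice Literature.Probability.LatticeModels
open Literature.MathematicalPhysics.QuantumLattice.BandSectorCounting
open Summit.HubbardSuperconductivity.HubbardSuperconductivity.Theorems.TwoPointAssembly
open Summit.HubbardSuperconductivity.HubbardSuperconductivity.Theorems.KLProgrammeLegKernels
open Summit.HubbardSuperconductivity.HubbardSuperconductivity.Theorems.KLRegimeWick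
open Summit.HubbardSuperconductivity.HubbardSuperconductivity.Theorems.EngineV8
open Summit.HubbardSuperconductivity.HubbardSuperconductivity.Theorems.DispersionFlow
open Summit.HubbardSuperconductivity.HubbardSuperconductivity.Theorems.PerturbedFermiCurve

variable {L M : ℕ} [NeZero L] [NeZero M]

/-- **THE FREQUENCY-PINNED PART OF THE ZERO-TRANSFER p-h VALUE ROW (module docstring).** [cite: BenfattoGiulianiMastropietro2006, §2.4–§2.5] -/
theorem klph_phValue_row_le {β : ℝ} (hβ : 0 < β) (μ : ℝ) {K : TrigPolyC4v}
    {a b : ℝ} (B : BandBounds a b) {A : ℝ} (hA : ∀ p : Momentum, ∀ j ≤ 2, ‖iteratedFDeriv ℝ j (frameShift K) p‖ ≤ A) (hADt : 2 * A < B.Dtmin)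
    {r : ℝ} (hlo : a < μ - r - A) (hhi : μ + r + A < b) (n : ℕ) {t : ℝ} (ht : t ∈ Icc (0 : ℝ) 1)
    (Φ : ℕ → ℝ → FreqMomentum L M → ℝ) (hΦ : Φ = fun j t k => (softSymbolCompl L M β μ K (n + 1) j) k + (hubbardCutoffWeightCT L M β μ K (klScale klE0 (n + 1)) k -
            hubbardCutoffWeightCT L M β μ K (klScale klE0 n + t * (klScale klE0 (n + 1) - klScale klE0 n)) k))
    (Wd : ℝ → FreqMomentum L M → ℝ) (hWd : Wd = fun t k => deriv (fun Λ' : ℝ => hubbardCutoffWeightCT L M β μ K Λ' k) (klScale klE0 n + t * (klScale klE0 (n + 1) - klScale klE0 n)))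
    (j : ℕ) (hΛr : klScale klE0 n + t * (klScale klE0 (n + 1) - klScale klE0 n) < r)
    (hM : β * (klScale klE0 n + t * (klScale klE0 (n + 1) - klScale klE0 n)) / (2 * Real.pi) + 1 ≤ M)
    {Mg ℓ r₁ : ℝ} (hr₁ : 0 < r₁)
    (hbd : ∀ s, |klWd (klScale klE0 n + t * (klScale klE0 (n + 1) - klScale klE0 n)) s *
      klPhi (klScale klE0 j) (klScale klE0 n + t * (klScale klE0 (n + 1) - klScale klE0 n)) s| ≤ Mg)
    (hlip : ∀ s s', |klWd (klScale klE0 n + t * (klScale klE0 (n + 1) - klScale klE0 n)) s *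
        klPhi (klScale klE0 j) (klScale klE0 n + t * (klScale klE0 (n + 1) - klScale klE0 n)) s -
      klWd (klScale klE0 n + t * (klScale klE0 (n + 1) - klScale klE0 n)) s' *
        klPhi (klScale klE0 j) (klScale klE0 n + t * (klScale klE0 (n + 1) - klScale klE0 n)) s'| ≤ ℓ * |s - s'|)
    (hin : ∀ s, s ≤ r₁ ^ 2 → klWd (klScale klE0 n + t * (klScale klE0 (n + 1) - klScale klE0 n)) s *
      klPhi (klScale klE0 j) (klScale klE0 n + t * (klScale klE0 (n + 1) - klScale klE0 n)) s = 0)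
    (hout : ∀ s, (klScale klE0 n + t * (klScale klE0 (n + 1) - klScale klE0 n)) ^ 2 ≤ s →
      klWd (klScale klE0 n + t * (klScale klE0 (n + 1) - klScale klE0 n)) s *
        klPhi (klScale klE0 j) (klScale klE0 n + t * (klScale klE0 (n + 1) - klScale klE0 n)) s = 0)
    (V₀ : Fin 2 → ℂ) :
    (klScale klE0 n - klScale klE0 (n + 1)) * ((β * (L : ℝ) ^ 2) ^ 3)⁻¹ *
      ‖∑ p : FreqMomentum L M, ∑ σ : Fin 2,
        (((((Wd t p) : ℝ) : ℂ) * (((β * (L : ℝ) ^ 2 : ℝ) : ℂ) * propCT L M β μ K p)) * ((((Φ j t p) : ℝ) : ℂ) * (((β * (L : ℝ) ^ 2 : ℝ) : ℂ) * propCT L M β μ K p))) *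
          V₀ σ‖ ≤
      (klScale klE0 n - klScale klE0 (n + 1)) * ‖∑ σ : Fin 2, V₀ σ‖ *
        (((2 * π) ^ 2)⁻¹ * (2 * π * (π * Real.sqrt 2 / (B.Dtmin - 2 * A)) *
              ((2 * (klScale klE0 n + t * (klScale klE0 (n + 1) - klScale klE0 n)) * (2 * (klScale klE0 n + t * (klScale klE0 (n + 1) - klScale klE0 n)) *
                (2 * (klScale klE0 n + t * (klScale klE0 (n + 1) - klScale klE0 n)) ^ 2 * (ℓ / r₁ ^ 4 + 2 * Mg / r₁ ^ 6) + (ℓ / r₁ ^ 2 + Mg / r₁ ^ 4)))) *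
                ((klScale klE0 n + t * (klScale klE0 (n + 1) - klScale klE0 n)) + 2 * Real.pi / β) / β) +
            β⁻¹ * (((klScale klE0 n + t * (klScale klE0 (n + 1) - klScale klE0 n)) * β / π + 1) *
              (2 * (klScale klE0 n + t * (klScale klE0 (n + 1) - klScale klE0 n)) *
                (2 * π * (1 / (B.Dtmin - 2 * A) ^ 2 + Real.pi * Real.sqrt 2 * (2 + 4 * A) / (B.Dtmin - 2 * A) ^ 3) *
                  (klScale klE0 n + t * (klScale klE0 (n + 1) - klScale klE0 n)) * (Mg / r₁ ^ 2))))) +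
          ((klScale klE0 n + t * (klScale klE0 (n + 1) - klScale klE0 n)) / π + 3 / β) *
            (2 * π * (2 * (klScale klE0 n + t * (klScale klE0 (n + 1) - klScale klE0 n)) *
              (2 * (klScale klE0 n + t * (klScale klE0 (n + 1) - klScale klE0 n)) ^ 2 * (ℓ / r₁ ^ 4 + 2 * Mg / r₁ ^ 6) + (ℓ / r₁ ^ 2 + Mg / r₁ ^ 4)) *
              (4 + 2 * A)) / L)) := by
  set Λt : ℝ := klScale klE0 n + t * (klScale klE0 (n + 1) - klScale klE0 n) with hΛt
  have hβ0 : β ≠ 0 := hβ.ne'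
  have hL : (0 : ℝ) < L := by exact_mod_cast Nat.pos_of_ne_zero (NeZero.ne L)
  have hβL : 0 < β * (L : ℝ) ^ 2 := by positivity
  have hΛ1 := klth_klScale_pos (n + 1)
  have hsucc : klScale klE0 (n + 1) = klScale klE0 n / 4 := klth_klScale_succ n
  have hΛt1 : klScale klE0 (n + 1) ≤ Λt := by rw [hΛt, hsucc]; obtain ⟨h0, h1⟩ := ht; nlinarith
  have hΛt0 : 0 < Λt := hΛ1.trans_le hΛt1
  -- the double sum factorises: `(βL²)²·(Σ_σ V₀ σ)·Σ_p G(s_p)·ĝ_p²`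
  have hsum : ∑ p : FreqMomentum L M, ∑ σ : Fin 2,
        (((((Wd t p) : ℝ) : ℂ) * (((β * (L : ℝ) ^ 2 : ℝ) : ℂ) * propCT L M β μ K p)) * ((((Φ j t p) : ℝ) : ℂ) * (((β * (L : ℝ) ^ 2 : ℝ) : ℂ) * propCT L M β μ K p))) * V₀ σ =
      (((β * (L : ℝ) ^ 2 : ℝ)) : ℂ) ^ 2 * (∑ σ : Fin 2, V₀ σ) *
        ∑ p : FreqMomentum L M, (((klWd Λt (matsubaraFreq β M p.1 ^ 2 + nambuXiCT L μ K p.2 ^ 2) *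
            klPhi (klScale klE0 j) Λt (matsubaraFreq β M p.1 ^ 2 + nambuXiCT L μ K p.2 ^ 2) : ℝ)) : ℂ) * propCT L M β μ K p ^ 2 := by
    rw [mul_sum]
    refine sum_congr rfl fun p _ => ?_
    rw [hWd, hΦ, klok_bornLines_eq hβ0 μ K n j hΛt0.ne' p, ← mul_sum]
    ring
  have hrot := klph_lattice_rotation_le' B hA hADt hlo hhi hβ hbd hlip hin hout hr₁ hΛt0 hΛr hM L
  have hG := klph_sum_propCT_sq_eq (L := L) (M := M) hβ0 μ K (fun s => klWd Λt s * klPhi (klScale klE0 j) Λt s)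
  beta_reduce at hG
  rw [hsum, hG, norm_mul, norm_mul, norm_pow, Complex.norm_real, Real.norm_of_nonneg hβL.le, Complex.norm_real, Real.norm_eq_abs]
  -- normalisation: `(Λd)((βL²)³)⁻¹·(βL²)²·‖ΣV₀‖·|S| = (Λd)·‖ΣV₀‖·|β⁻¹(L²)⁻¹S|`
  have hL2 : (((L ^ 2 : ℕ) : ℝ)) = (L : ℝ) ^ 2 := by push_cast; ring
  rw [hL2] at hrot
  have hnorm : ∀ S : ℝ, (klScale klE0 n - klScale klE0 (n + 1)) * ((β * (L : ℝ) ^ 2) ^ 3)⁻¹ * ((β * (L : ℝ) ^ 2) ^ 2 * ‖∑ σ : Fin 2, V₀ σ‖ * |S|) =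
      (klScale klE0 n - klScale klE0 (n + 1)) * ‖∑ σ : Fin 2, V₀ σ‖ * |β⁻¹ * (((L : ℝ) ^ 2)⁻¹ * S)| := by
    intro S
    rw [abs_mul, abs_mul, abs_of_pos (inv_pos.2 hβ), abs_of_pos (inv_pos.2 (by positivity : (0 : ℝ) < (L : ℝ) ^ 2))]
    field_simp
  rw [hnorm]
  have hfac : 0 ≤ (klScale klE0 n - klScale klE0 (n + 1)) * ‖∑ σ : Fin 2, V₀ σ‖ := by
    have : 0 ≤ klScale klE0 n - klScale klE0 (n + 1) := by rw [hsucc]; linarith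
    positivity
  exact mul_le_mul_of_nonneg_left hrot hfac

end Summit.HubbardSuperconductivity.HubbardSuperconductivity.Theorems.KLRegimeSplit

end
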